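import Mathlib
import Summits.CriticalPhenomena.CardyFormulaZ2.Theorems.CardySelfRefinementTrivialSectorRateStubFourArmAboveOneSecondMomentTail
import Literature.Probability.Percolation.LatticeSymmetry
import HarnessLib

/-!
# Helper (W1a) of stub `stub_boundaryRelevance`, line `far-field-is-a-quarter-turn`
(crux `TrivialSectorRate`, stmt-CriticalPhenomena-10266): the recentred, vertex-restricted BK-type
tail bound `M_k(Z' ≥ n) ≤ M_k(A')^n` for the number of crossing clusters, `k ≤ 3`

The probabilistic input of the docked half-plane two-arm window bound for the self-refinement
model `M_k(q)` (Werner's cluster counting): van den Berg–Nolin's tail bound for the number `Z'` of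
crossing clusters of the configuration TRANSLATED by `c` and RESTRICTED to the edges with both
endpoints in a vertex set `V₀` (a half-plane in the application; the restriction may split clusters).

* `readout_shift_inter_preimage_subset_disjointOccurrencePow` — on the COIN space, under the second
  read-out `rd` (`exists_readout`), `{Z' ≥ n}` pulls back into the `n`-fold disjoint occurrence of
  the pull-back of the restricted crossing event: the open walks of `n` distinct crossing clusters of
  `(rd S + c) ∩ E`, `E = {e | ∀ z ∈ e, z ∈ V₀}`, un-shifted by `c`, carry the coin certificates of
  `readout_preimage_subset_disjointOccurrencePow`; a coin common to two of them forces two sub-edges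
  of ONE bundle into the two walks, which either share a vertex or (selector on, `k = 3`, `e₀`/`e₂`)
  are joined by the open middle sub-edge, whose endpoints are walk vertices — in `V₀` and in the
  box — so the two clusters would meet in the restricted box graph.  (For an edge set NOT induced by
  a vertex set the bound fails: drop `e₁ + c` from `E`; `k = 3`, `q = (1, 1)`, `n = 2` gives
  `1/2 > 1/4`.)
* `M_real_setOf_le_numCrossingClusters_shift_induce_le_pow` — **`M_k(q)(Z' ≥ n) ≤ M_k(q)(A')^n`** by the
  law identity of `rd`, locality of the pulled-back event
  (`determinedBy_preimage_shift_inter_boxCrossingEvent`, `determinedBy_preimage_readout`) and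
  iterated Reimer on the coin product (`prodBernoulli_real_disjointOccurrencePow_le`).

References: J. van den Berg, P. Nolin, Progr. Probab. 77 (2020), §3 (eq:upper_bd_C); W. Werner,
*Lectures on two-dimensional critical percolation*, PCMI 2007 (IAS/Park City Math. Ser. 16, 2009),
first exercise sheet; D. Reimer, Combin. Probab. Comput. 9 (2000).
-/

noncomputable section

namespace Summit.CriticalPhenomena.CardyFormulaZ2.Theorems.CardySelfRefinement.FarField

open scoped Classical
open Set MeasureTheory ProbabilityTheory SimpleGraph
open Literature.Probability.LatticeModels Literature.Probability.Percolation
open Literature.Probability.Percolation.QuadCrossing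
open Summit.CriticalPhenomena.CardyFormulaZ2.Theses.CardySelfRefinement

/-- **Distinct crossing clusters of the translated, vertex-restricted configuration have
coin-disjoint certificates under the second read-out (`k ≤ 3`)**: if the configuration read from
the coins `S` through `rd`, translated by `c` and restricted to the edges with both endpoints in
`V₀`, has `n` distinct open clusters of `B(R)` joining `B(N)` to `‖·‖_∞ = R`, then `S` lies in the
`n`-fold disjoint occurrence, ON THE COIN SPACE, of the pull-back of `boxCrossingEvent N R` through
the same composite read-out. -/
theorem readout_shift_inter_preimage_subset_disjointOccurrencePow {k : ℕ} (hk : 0 < k) (hk3 : k ≤ 3)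
    {rd : Set Coin → Set (Sym2 (Site 2))}
    (hrd : ∀ (S : Set Coin) (v : Site 2) (d : Fin 2), edgeOf (v, d) ∈ rd S ↔ (if ax k (v, d) then
          ((tb k (v, d), d, (2 : Fin 3)) ∈ S ∧ (tb k (v, d), d, (1 : Fin 3)) ∈ S) ∨
            ((tb k (v, d), d, (2 : Fin 3)) ∉ S ∧
              (((∀ i, (k : ℤ) ∣ v i) ∧ (tb k (v, d), d, (1 : Fin 3)) ∈ S) ∨
                ((¬ ∀ i, (k : ℤ) ∣ v i) ∧ (v, d, (0 : Fin 3)) ∈ S)))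
        else (v, d, (0 : Fin 3)) ∈ S))
    (hrde : ∀ (S : Set Coin) (e : Sym2 (Site 2)), e ∈ rd S → ∃ vd : Site 2 × Fin 2, e = edgeOf vd)
    (c : Site 2) (V₀ : Set (Site 2)) (N R n : ℕ) :
    rd ⁻¹' ((fun ω => BondConfig.relabel (sym2Equiv (Site.shift c)) ω ∩ {e | ∀ z ∈ e, z ∈ V₀}) ⁻¹'
        {ω | n ≤ numCrossingClusters ω N R}) ⊆
      disjointOccurrencePow (rd ⁻¹' ((fun ω => BondConfig.relabel (sym2Equiv (Site.shift c)) ω ∩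
        {e | ∀ z ∈ e, z ∈ V₀}) ⁻¹' boxCrossingEvent N R)) n := by
  intro S hS
  -- the translated and restricted configuration read from the coins
  set T : Set Coin → Set (Sym2 (Site 2)) := fun S' =>
    BondConfig.relabel (sym2Equiv (Site.shift c)) (rd S') ∩ {e | ∀ z ∈ e, z ∈ V₀} with hT
  have hTmem : ∀ (S' : Set Coin) (x y : Site 2), s(x + c, y + c) ∈ T S' ↔
      s(x, y) ∈ rd S' ∧ x + c ∈ V₀ ∧ y + c ∈ V₀ := by
    intro S' x y
    simp only [hT, Set.mem_inter_iff, mk_add_mem_relabel_shift_iff, Set.mem_setOf_eq, Sym2.mem_iff,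
      forall_eq_or_imp, forall_eq]
  change n ≤ numCrossingClusters (T S) N R at hS
  rw [numCrossingClusters] at hS
  letI := Fintype.ofFinite {C // IsCrossingCluster (T S) N R C}
  rw [Nat.card_eq_fintype_card] at hS
  obtain ⟨ι, -⟩ : ∃ f : Fin n ↪ {C // IsCrossingCluster (T S) N R C}, True :=
    ⟨(Fin.castLEEmb hS).trans (Fintype.equivFin _).symm.toEmbedding, trivial⟩
  have hwalk : ∀ i : Fin n, ∃ w : (boxOpenGraph (T S) R).Walk (innerRep (ι i)) (outerRep (ι i)), True :=
    fun i => by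
      obtain ⟨w⟩ : (boxOpenGraph (T S) R).Reachable (innerRep (ι i)) (outerRep (ι i)) :=
        ConnectedComponent.exact ((mk_innerRep (ι i)).trans (mk_outerRep (ι i)).symm)
      exact ⟨w, trivial⟩
  choose w _ using hwalk
  -- vertices of the walks and their clusters
  have hclu : ∀ (i : Fin n) (a : Site 2), a ∈ (w i).support →
      (boxOpenGraph (T S) R).connectedComponentMk a = (ι i).1 := by
    intro i a ha
    rw [← mk_innerRep (ι i)]
    exact (ConnectedComponent.sound ((w i).takeUntil a ha).reachable).symm
  have hsame : ∀ (i j : Fin n) (a : Site 2), a ∈ (w i).support → a ∈ (w j).support → i = j :=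
    fun i j a hai haj => ι.injective (Subtype.ext ((hclu i a hai).symm.trans (hclu j a haj)))
  -- an open un-shifted edge `s(a, b)` between vertices of the two walks identifies the clusters
  have hlink : ∀ (i j : Fin n) (a b : Site 2), a + c ∈ (w i).support → b + c ∈ (w j).support →
      a + c ∈ V₀ → b + c ∈ V₀ → a + c ∈ box 2 R → b + c ∈ box 2 R → a ≠ b → s(a, b) ∈ rd S → i = j := by
    intro i j a b ha hb hVa hVb hba hbb hne hab
    refine ι.injective (Subtype.ext ?_)
    rw [← hclu i _ ha, ← hclu j _ hb]
    exact ConnectedComponent.sound (boxOpenGraph_adj.2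
      ⟨(hTmem S a b).2 ⟨hab, hVa, hVb⟩, hba, hbb, fun h => hne (add_right_cancel h)⟩).reachable
  -- edges of the walks, un-shifted
  have hedge : ∀ (i : Fin n) (v : Site 2) (d : Fin 2), s(v + c, v + dirVec d + c) ∈ (w i).edges →
      edgeOf (v, d) ∈ rd S ∧ v + c ∈ V₀ ∧ v + dirVec d + c ∈ V₀ ∧ v + c ∈ box 2 R ∧
        v + dirVec d + c ∈ box 2 R ∧ v + c ∈ (w i).support ∧ v + dirVec d + c ∈ (w i).support := by
    intro i v d he
    have he' := (w i).edges_subset_edgeSet he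
    rw [mem_edgeSet] at he'
    obtain ⟨hmem, hx, hy, -⟩ := boxOpenGraph_adj.1 he'
    obtain ⟨hrdS, hV, hV1⟩ := (hTmem S v (v + dirVec d)).1 hmem
    exact ⟨hrdS, hV, hV1, hx, hy, (w i).fst_mem_support_of_mem_edges he,
      (w i).snd_mem_support_of_mem_edges he⟩
  -- the sub-edges of a bundle whose selector and shared coin are on are all open
  have hsub : ∀ (u : Site 2) (d : Fin 2) (p : ℕ), p < k → (u, d, (2 : Fin 3)) ∈ S → (u, d, (1 : Fin 3)) ∈ S →
      edgeOf ((fun i => (k : ℤ) * u i + (p : ℤ) * dirVec d i), d) ∈ rd S := by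
    intro u d p hp hsel hsh
    have hk0 : (k : ℤ) ≠ 0 := by exact_mod_cast hk.ne'
    have hax : ax k ((fun i => (k : ℤ) * u i + (p : ℤ) * dirVec d i), d) := by
      show (k : ℤ) ∣ (k : ℤ) * u (if d = 0 then 1 else 0) + (p : ℤ) * dirVec d (if d = 0 then 1 else 0)
      have hne : (if d = 0 then (1 : Fin 2) else 0) ≠ d := by fin_cases d <;> decide
      rw [dirVec_apply_of_ne hne, mul_zero, add_zero]
      exact dvd_mul_right _ _
    have htb : tb k ((fun i => (k : ℤ) * u i + (p : ℤ) * dirVec d i), d) = u := by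
      funext i
      simp only [tb]
      by_cases hid : i = d
      · subst hid
        rw [dirVec_apply_self, mul_one, add_comm, Int.add_mul_ediv_left _ _ hk0,
          Int.ediv_eq_zero_of_lt (by positivity) (by exact_mod_cast hp), zero_add]
      · rw [dirVec_apply_of_ne hid, mul_zero, add_zero, Int.mul_ediv_cancel_left _ hk0]
    rw [hrd, if_pos hax, htb]
    exact Or.inl ⟨hsel, hsh⟩
  -- certificates (of the un-shifted edges)
  set cert : Site 2 × Fin 2 → Set Coin := fun vd =>
    if ax k vd then
      (if (k : ℤ) ∣ vd.1 vd.2 then {(tb k vd, vd.2, (1 : Fin 3))}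
        else if (tb k vd, vd.2, (2 : Fin 3)) ∈ S then {(tb k vd, vd.2, (2 : Fin 3)), (tb k vd, vd.2, (1 : Fin 3))}
        else {(tb k vd, vd.2, (2 : Fin 3)), (vd.1, vd.2, (0 : Fin 3))})
    else {(vd.1, vd.2, (0 : Fin 3))} with hcert
  set K : Fin n → Set Coin := fun i =>
    ⋃ vd ∈ {vd : Site 2 × Fin 2 | s(vd.1 + c, vd.1 + dirVec vd.2 + c) ∈ (w i).edges}, cert vd with hK
  refine mem_disjointOccurrencePow_of_certificates K (fun i S' hS' => ?_) (fun i j hij => ?_)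
  · -- (1) the certificate of the `i`-th walk certifies a restricted crossing
    have hagree : ∀ vd : Site 2 × Fin 2, s(vd.1 + c, vd.1 + dirVec vd.2 + c) ∈ (w i).edges →
        ∀ a ∈ cert vd, (a ∈ S' ↔ a ∈ S) :=
      fun vd hvd a ha => hS' a (Set.mem_iUnion₂.2 ⟨vd, hvd, ha⟩)
    have hopen : ∀ e ∈ (w i).edges, e ∈ (boxOpenGraph (T S') R).edgeSet := by
      intro e he
      have he' := (w i).edges_subset_edgeSet he
      induction e using Sym2.ind with
      | h x y =>
        rw [mem_edgeSet] at he' ⊢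
        obtain ⟨hxy, hx, hy, hne⟩ := boxOpenGraph_adj.1 he'
        refine boxOpenGraph_adj.2 ⟨?_, hx, hy, hne⟩
        -- un-shift the edge
        have hxy1 : s(x - c, y - c) ∈ rd S := by
          have h1 := hxy.1
          rw [BondConfig.mem_relabel_iff] at h1
          simpa using h1
        obtain ⟨⟨v, d⟩, hvd⟩ := hrde S _ hxy1
        have hxy2 : s(x, y) = s(v + c, v + dirVec d + c) := by
          simpa using congrArg (Sym2.map (Site.shift c)) hvd
        rw [hxy2] at hxy he ⊢
        rw [hTmem] at hxy ⊢
        refine ⟨?_, hxy.2.1, hxy.2.2⟩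
        have hag := hagree (v, d) he
        have hO := (hrd S v d).1 hxy.1
        refine (hrd S' v d).2 ?_
        by_cases hax : ax k (v, d)
        · rw [if_pos hax] at hO ⊢
          by_cases hdv : (k : ℤ) ∣ v d
          · -- first sub-edge: the shared coin certifies
            have hall : ∀ i, (k : ℤ) ∣ v i := (forall_dvd_iff_of_ax hax).2 hdv
            have hsh : (tb k (v, d), d, (1 : Fin 3)) ∈ S := by
              rcases hO with ⟨-, h⟩ | ⟨-, ⟨-, h⟩ | ⟨h, -⟩⟩ <;> first | exact h | exact absurd hall h
            have hsh' : (tb k (v, d), d, (1 : Fin 3)) ∈ S' :=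
              (hag _ (by simp [hcert, hax, hdv])).2 hsh
            by_cases hsel' : (tb k (v, d), d, (2 : Fin 3)) ∈ S'
            · exact Or.inl ⟨hsel', hsh'⟩
            · exact Or.inr ⟨hsel', Or.inl ⟨hall, hsh'⟩⟩
          · have hnall : ¬ ∀ i, (k : ℤ) ∣ v i := fun h => hdv (h d)
            by_cases hsel : (tb k (v, d), d, (2 : Fin 3)) ∈ S
            · have hsh : (tb k (v, d), d, (1 : Fin 3)) ∈ S := by
                rcases hO with ⟨-, h⟩ | ⟨h, -⟩ <;> first | exact h | exact absurd hsel h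
              have hsel' : (tb k (v, d), d, (2 : Fin 3)) ∈ S' := (hag _ (by simp [hcert, hax, hdv, hsel])).2 hsel
              have hsh' : (tb k (v, d), d, (1 : Fin 3)) ∈ S' := (hag _ (by simp [hcert, hax, hdv, hsel])).2 hsh
              exact Or.inl ⟨hsel', hsh'⟩
            · have hown : (v, d, (0 : Fin 3)) ∈ S := by
                rcases hO with ⟨h, -⟩ | ⟨-, ⟨h, -⟩ | ⟨-, h⟩⟩ <;>
                  first | exact h | exact absurd h hsel | exact absurd h hnall
              have hsel' : (tb k (v, d), d, (2 : Fin 3)) ∉ S' := fun h =>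
                hsel ((hag _ (by simp [hcert, hax, hdv, hsel])).1 h)
              have hown' : (v, d, (0 : Fin 3)) ∈ S' := (hag _ (by simp [hcert, hax, hdv, hsel])).2 hown
              exact Or.inr ⟨hsel', Or.inr ⟨hnall, hown'⟩⟩
        · rw [if_neg hax] at hO ⊢
          exact (hag _ (by simp [hcert, hax])).2 hO
    exact ⟨innerRep (ι i), innerRep_mem (ι i), outerRep (ι i), outerRep_mem (ι i),
      ((w i).transfer (boxOpenGraph (T S') R) hopen).reachable⟩
  · -- (2) certificates of distinct clusters are disjoint
    refine Set.disjoint_left.2 fun a hai haj => hij ?_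
    obtain ⟨⟨v, d⟩, hvd, ha⟩ := Set.mem_iUnion₂.1 hai
    obtain ⟨⟨v', d'⟩, hvd', ha'⟩ := Set.mem_iUnion₂.1 haj
    simp only [Set.mem_setOf_eq] at hvd hvd'
    obtain ⟨hrdv, hVv, hVv1, hbv, hbv1, hsv, hsv1⟩ := hedge i v d hvd
    obtain ⟨-, hVv', hVv1', hbv', hbv1', hsv', hsv1'⟩ := hedge j v' d' hvd'
    -- two sub-edges of one bundle at positions `p`, `p'` at most `1` apart share a walk vertex
    have hnear : ∀ p p' : ℕ, d = d' → (∀ i, v' i = v i + ((p' : ℤ) - p) * dirVec d i) →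
        (p' = p ∨ p' = p + 1 ∨ p = p' + 1) → i = j := by
      rintro p p' hdd hrel (rfl | rfl | rfl)
      · have : v' = v := funext fun i => by rw [hrel i]; ring
        rw [this] at hsv'
        exact hsame i j (v + c) hsv hsv'
      · have : v' = v + dirVec d := funext fun i => by rw [Pi.add_apply, hrel i]; push_cast; ring
        rw [this] at hsv'
        exact hsame i j _ hsv1 hsv'
      · have : v = v' + dirVec d' := funext fun i => by rw [Pi.add_apply, hrel i, hdd]; push_cast; ring
        rw [this] at hsv
        exact hsame i j _ hsv hsv1'
    -- what a common coin says about the two edges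
    have hmem : ∀ (v : Site 2) (d : Fin 2) (x : Site 2) (d₀ : Fin 2) (l : Fin 3), ((x, d₀, l) : Coin) ∈ cert (v, d) →
        (l = 0 ∧ x = v ∧ d₀ = d) ∨
        (l = 1 ∧ ax k (v, d) ∧ x = tb k (v, d) ∧ d₀ = d ∧ ((k : ℤ) ∣ v d ∨ (tb k (v, d), d, (2 : Fin 3)) ∈ S)) ∨
        (l = 2 ∧ ax k (v, d) ∧ x = tb k (v, d) ∧ d₀ = d ∧ ¬ (k : ℤ) ∣ v d) := by
      intro v d x d₀ l hc
      by_cases hax : ax k (v, d)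
      · by_cases hdv : (k : ℤ) ∣ v d
        · simp only [hcert, hax, hdv, if_true, Set.mem_singleton_iff, Prod.mk.injEq] at hc
          exact Or.inr (Or.inl ⟨hc.2.2, hax, hc.1, hc.2.1, Or.inl hdv⟩)
        · by_cases hsel : (tb k (v, d), d, (2 : Fin 3)) ∈ S
          · simp only [hcert, hax, hdv, hsel, if_true, if_false, Set.mem_insert_iff, Set.mem_singleton_iff,
              Prod.mk.injEq] at hc
            rcases hc with ⟨h1, h2, h3⟩ | ⟨h1, h2, h3⟩
            · exact Or.inr (Or.inr ⟨h3, hax, h1, h2, hdv⟩)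
            · exact Or.inr (Or.inl ⟨h3, hax, h1, h2, Or.inr hsel⟩)
          · simp only [hcert, hax, hdv, hsel, if_true, if_false, Set.mem_insert_iff, Set.mem_singleton_iff,
              Prod.mk.injEq] at hc
            rcases hc with ⟨h1, h2, h3⟩ | ⟨h1, h2, h3⟩
            · exact Or.inr (Or.inr ⟨h3, hax, h1, h2, hdv⟩)
            · exact Or.inl ⟨h3, h1, h2⟩
      · simp only [hcert, hax, if_false, Set.mem_singleton_iff, Prod.mk.injEq] at hc
        exact Or.inl ⟨hc.2.2, hc.1, hc.2.1⟩
    obtain ⟨x, d₀, l⟩ := a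
    have H1 := hmem v d x d₀ l ha
    have H2 := hmem v' d' x d₀ l ha'
    fin_cases l
    · -- a common own coin: the same edge
      rcases H1 with ⟨-, rfl, rfl⟩ | ⟨h, -⟩ | ⟨h, -⟩ <;> try exact absurd h (by decide)
      rcases H2 with ⟨-, rfl, rfl⟩ | ⟨h, -⟩ | ⟨h, -⟩ <;> try exact absurd h (by decide)
      exact hsame i j (x + c) hsv hsv'
    · -- a common shared coin: the same bundle, selector on (all sub-edges open) or both first sub-edges
      obtain ⟨hax, hx, rfl, hor⟩ : ax k (v, d) ∧ x = tb k (v, d) ∧ d₀ = d ∧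
          ((k : ℤ) ∣ v d ∨ (tb k (v, d), d, (2 : Fin 3)) ∈ S) := by
        rcases H1 with ⟨h, -⟩ | ⟨-, h⟩ | ⟨h, -⟩ <;> first | exact h | exact absurd h (by decide)
      obtain ⟨hax', hx', rfl, hor'⟩ : ax k (v', d') ∧ x = tb k (v', d') ∧ d₀ = d' ∧
          ((k : ℤ) ∣ v' d' ∨ (tb k (v', d'), d', (2 : Fin 3)) ∈ S) := by
        rcases H2 with ⟨h, -⟩ | ⟨-, h⟩ | ⟨h, -⟩ <;> first | exact h | exact absurd h (by decide)
      have htb : tb k (v', d₀) = tb k (v, d₀) := hx'.symm.trans hx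
      obtain ⟨p, hp, hvp⟩ := exists_pos_of_ax hk hax
      obtain ⟨p', hp', hvp'⟩ := exists_pos_of_ax hk hax'
      have hrel : ∀ i, v' i = v i + ((p' : ℤ) - p) * dirVec d₀ i := fun i => by
        rw [hvp' i, hvp i, htb]; ring
      by_cases hsel : (tb k (v, d₀), d₀, (2 : Fin 3)) ∈ S
      · -- selector on: all (`≤ 3`, consecutive) sub-edges of the bundle are open; `e_p`, `e_{p+2}` are
        -- joined by the middle one, whose endpoints are walk vertices (in `V₀` and in the box)
        have hsh : (tb k (v, d₀), d₀, (1 : Fin 3)) ∈ S := by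
          have hO := (hrd S v d₀).1 hrdv
          rw [if_pos hax] at hO
          rcases hO with ⟨-, h⟩ | ⟨h, -⟩ <;> first | exact h | exact absurd hsel h
        have hcases : (p' = p ∨ p' = p + 1 ∨ p = p' + 1) ∨ p' = p + 2 ∨ p = p' + 2 := by omega
        rcases hcases with h | rfl | rfl
        · exact hnear p p' rfl hrel h
        · have h1 := hsub (tb k (v, d₀)) d₀ (p + 1) (by omega) hsel hsh
          have heq : (fun i => (k : ℤ) * tb k (v, d₀) i + ((p + 1 : ℕ) : ℤ) * dirVec d₀ i) = v + dirVec d₀ :=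
            funext fun i => by rw [Pi.add_apply, hvp i]; push_cast; ring
          have hv' : v' = v + dirVec d₀ + dirVec d₀ := funext fun i => by
            rw [Pi.add_apply, Pi.add_apply, hrel i]; push_cast; ring
          refine hlink i j _ _ hsv1 hsv' hVv1 hVv' hbv1 hbv' (fun h => ?_) (by rw [heq] at h1; rw [hv']; exact h1)
          have h' := congrFun h d₀
          simp only [hv', Pi.add_apply, dirVec_apply_self] at h'
          linarith
        · have h1 := hsub (tb k (v, d₀)) d₀ (p' + 1) (by omega) hsel hsh
          have heq : (fun i => (k : ℤ) * tb k (v, d₀) i + ((p' + 1 : ℕ) : ℤ) * dirVec d₀ i) = v' + dirVec d₀ :=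
            funext fun i => by rw [Pi.add_apply, hvp' i, htb]; push_cast; ring
          have hv : v = v' + dirVec d₀ + dirVec d₀ := funext fun i => by
            rw [Pi.add_apply, Pi.add_apply, hrel i]; push_cast; ring
          refine (hlink j i _ _ hsv1' hsv hVv1' hVv hbv1' hbv (fun h => ?_)
            (by rw [heq] at h1; rw [hv]; exact h1)).symm
          have h' := congrFun h d₀
          simp only [hv, Pi.add_apply, dirVec_apply_self] at h'
          linarith
      · -- selector off: both edges are the first sub-edge of the bundle
        have hp0 : p = 0 := (pos_eq_zero_iff hp hvp).1 (hor.resolve_right hsel)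
        have hp0' : p' = 0 := (pos_eq_zero_iff hp' hvp').1 (hor'.resolve_right (by rwa [htb]))
        exact hnear p p' rfl hrel (Or.inl (hp0'.trans hp0.symm))
    · -- a common selector: two non-first sub-edges of the same bundle, which are consecutive
      obtain ⟨hax, hx, rfl, hndv⟩ : ax k (v, d) ∧ x = tb k (v, d) ∧ d₀ = d ∧ ¬ (k : ℤ) ∣ v d := by
        rcases H1 with ⟨h, -⟩ | ⟨h, -⟩ | ⟨-, h⟩ <;> first | exact h | exact absurd h (by decide)
      obtain ⟨hax', hx', rfl, hndv'⟩ : ax k (v', d') ∧ x = tb k (v', d') ∧ d₀ = d' ∧ ¬ (k : ℤ) ∣ v' d' := by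
        rcases H2 with ⟨h, -⟩ | ⟨h, -⟩ | ⟨-, h⟩ <;> first | exact h | exact absurd h (by decide)
      have htb : tb k (v', d₀) = tb k (v, d₀) := hx'.symm.trans hx
      obtain ⟨p, hp, hvp⟩ := exists_pos_of_ax hk hax
      obtain ⟨p', hp', hvp'⟩ := exists_pos_of_ax hk hax'
      have hrel : ∀ i, v' i = v i + ((p' : ℤ) - p) * dirVec d₀ i := fun i => by
        rw [hvp' i, hvp i, htb]; ring
      have hp0 : p ≠ 0 := fun h => hndv ((pos_eq_zero_iff hp hvp).2 h)
      have hp0' : p' ≠ 0 := fun h => hndv' ((pos_eq_zero_iff hp' hvp').2 h)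
      exact hnear p p' rfl hrel (by omega)

/-- The translated and restricted crossing event `{ω | (ω + c) ∩ E ∈ boxCrossingEvent N R}` is
determined by the pairs of the box `B(R + |c₀| + |c₁|) ⊇ B(R) - c`. -/
theorem determinedBy_preimage_shift_inter_boxCrossingEvent (c : Site 2) (E : Set (Sym2 (Site 2)))
    (N R : ℕ) :
    DeterminedBy ((fun ω => BondConfig.relabel (sym2Equiv (Site.shift c)) ω ∩ E) ⁻¹'
        boxCrossingEvent N R) ↑(boxEdges (R + (c 0).natAbs + (c 1).natAbs)) := by
  rw [determinedBy_iff]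
  intro ω ω' h
  simp only [Set.mem_preimage]
  -- a pair of `B(R)`, un-shifted, is a pair of the bigger box
  have key : ∀ x y : Site 2, x ∈ box 2 R → y ∈ box 2 R →
      (sym2Equiv (Site.shift c)).symm s(x, y) ∈ (↑(boxEdges (R + (c 0).natAbs + (c 1).natAbs)) :
        Set (Sym2 (Site 2))) := by
    intro x y hx hy
    rw [mem_box] at hx hy
    simp only [sym2Equiv_symm, sym2Equiv_apply, Sym2.map_mk, Site.shift_symm_apply, Finset.mem_coe,
      mk_mem_boxEdges, mem_box, Pi.sub_apply]
    have hx0 := hx 0; have hx1 := hx 1; have hy0 := hy 0; have hy1 := hy 1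
    refine ⟨fun i => ?_, fun i => ?_⟩ <;> fin_cases i <;> simp only [Fin.zero_eta, Fin.mk_one, Fin.isValue] <;> omega
  refine (determinedBy_iff _ _).1 (determinedBy_boxCrossingEvent N R) _ _ (Set.ext fun e => ?_)
  induction e using Sym2.ind with
  | h x y =>
    simp only [Set.mem_inter_iff, Finset.mem_coe, mk_mem_boxEdges, BondConfig.mem_relabel_iff]
    constructor
    · rintro ⟨⟨hω, hE⟩, hx, hy⟩
      exact ⟨⟨((Set.ext_iff.1 h _).1 ⟨hω, key x y hx hy⟩).1, hE⟩, hx, hy⟩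
    · rintro ⟨⟨hω, hE⟩, hx, hy⟩
      exact ⟨⟨((Set.ext_iff.1 h _).2 ⟨hω, key x y hx hy⟩).1, hE⟩, hx, hy⟩

/-- **Recentred, vertex-restricted BK-type tail bound for the number of crossing clusters under
`M_k`, `k ≤ 3`** (helper W1a of the stub `stub_boundaryRelevance`): for the configuration
translated by `c` (`BondConfig.relabel (sym2Equiv (Site.shift c))`) and restricted to the edges
with both endpoints in `V₀` (a half-plane in the application; the restriction may split clusters),
`M_k(q)(Z' ≥ n) ≤ M_k(q)(A')^n` for every `n`, where `Z'` is van den Berg–Nolin's number of open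
clusters of `B(R)` joining `B(N)` to `‖·‖_∞ = R` and `A'` the corresponding crossing event, both read
on the translated restricted configuration.  Proof: realise `M_k(q)` through the second read-out of
the coins (`exists_readout`), pull `{Z' ≥ n}` back into the `n`-fold coin-disjoint occurrence of the
pull-back of `A'` (`readout_shift_inter_preimage_subset_disjointOccurrencePow`), which is local
(`determinedBy_preimage_shift_inter_boxCrossingEvent`, `determinedBy_preimage_readout`), and iterate
Reimer's inequality on the coin product (`prodBernoulli_real_disjointOccurrencePow_le`).  The
vertex-induced form of the restriction is essential: for a general edge set the bound fails already
for `k = 3`, `q = (1, 1)`, `n = 2`. -/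
theorem M_real_setOf_le_numCrossingClusters_shift_induce_le_pow {k : ℕ} (hk : 0 < k) (hk3 : k ≤ 3)
    (q : ℝ × ℝ) (c : Site 2) (V₀ : Set (Site 2)) (N R n : ℕ) :
    (M k q.1 q.2).real {ω | n ≤ numCrossingClusters
        (BondConfig.relabel (sym2Equiv (Site.shift c)) ω ∩ {e | ∀ z ∈ e, z ∈ V₀}) N R} ≤
      ((M k q.1 q.2).real {ω | BondConfig.relabel (sym2Equiv (Site.shift c)) ω ∩ {e | ∀ z ∈ e, z ∈ V₀} ∈
        boxCrossingEvent N R}) ^ n := by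
  obtain ⟨rd, hrdm, hlaw, hrde, hrd⟩ := exists_readout hk q
  set F : BondConfig (Site 2) → BondConfig (Site 2) := fun ω =>
    BondConfig.relabel (sym2Equiv (Site.shift c)) ω ∩ {e | ∀ z ∈ e, z ∈ V₀}
  have hFm : Measurable F := (measurable_inter_right _).comp (BondConfig.relabel _).measurable
  have hZm : MeasurableSet (F ⁻¹' {ω | n ≤ numCrossingClusters ω N R}) :=
    (measurableSet_of_isLocalEvent_holds (isLocalEvent_setOf_numCrossingClusters N R (n ≤ ·))).preimage hFm
  have hAm : MeasurableSet (F ⁻¹' boxCrossingEvent N R) :=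
    (measurableSet_of_isLocalEvent_holds (isLocalEvent_boxCrossingEvent N R)).preimage hFm
  change (M k q.1 q.2).real (F ⁻¹' {ω | n ≤ numCrossingClusters ω N R}) ≤
    ((M k q.1 q.2).real (F ⁻¹' boxCrossingEvent N R)) ^ n
  rw [← hlaw, map_measureReal_apply hrdm hZm, map_measureReal_apply hrdm hAm]
  have hloc : IsLocalEvent (rd ⁻¹' (F ⁻¹' boxCrossingEvent N R)) :=
    ⟨_, determinedBy_preimage_readout hrd hrde
      (determinedBy_preimage_shift_inter_boxCrossingEvent c {e | ∀ z ∈ e, z ∈ V₀} N R)⟩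
  refine (measureReal_mono ?_).trans (prodBernoulli_real_disjointOccurrencePow_le (prm k q.1 q.2) hloc n)
  exact readout_shift_inter_preimage_subset_disjointOccurrencePow hk hk3 hrd hrde c V₀ N R n

end Summit.CriticalPhenomena.CardyFormulaZ2.Theorems.CardySelfRefinement.FarField

end
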